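import Summits.Ventures.HodgeRepro2.T5SU11JacobiCartanLawAsymptotic

/-!
# The joint limit law of the three rescaled coordinates is the diagonal exponential law

The three coordinates `log|a(g)|`, `|g·0|²` and `t(g)` of `g ∈ SU(1,1)` are deterministic increasing
functions of one another (`|g·0|² = 1 − |a|^{−2}`, `|a| = cosh t`), and each, rescaled by `k`, converges
in law to `Exp(1)` under `m_k φ_λ dν/m̂_k(λ)` (`T5SU11JacobiPhaseTailGroup`, `T5SU11JacobiOrbitLawAsymptotic`,
`T5SU11JacobiCartanLawAsymptotic`). The joint event is one threshold event for the phase,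

  `{x/k < log|a|} ∩ {2y/k < |g·0|²} ∩ {√(2z/k) < t} = {max(x/k, −½ log(1 − 2y/k), log cosh √(2z/k)) < log|a|}`
  (`setOf_joint_gt_eq`),

and `(k − 2)·max(…) → max(x, y, z)` (`tendsto_scaled_joint_threshold`; `Filter.Tendsto.max` and the three
threshold limits), so the general-threshold limit law gives

  **`P_{k,λ}(k log|a| > x, k|g·0|²/2 > y, k t²/2 > z) → e^{−max(x, y, z)}`**   (`tendsto_joint_tail_prob_atTop`)

for every real `λ`, `x ≥ 0`, `y > 0`, `z ≥ 0`: the joint law of `(k log|a|, k|g·0|²/2, k t²/2)` converges to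
the law of `(E, E, E)` with `E ∼ Exp(1)` — the three rescaled coordinates are asymptotically equal in
probability, not merely equal in law. Nothing is claimed about (N).

Blind lane: Mathlib + the HodgeRepro2 prefix only; no sorry; axioms ⊆ {propext, Classical.choice,
Quot.sound}.
-/

namespace Summit.Ventures.HodgeRepro2.T5SU11JacobiJointLawAsymptotic

open MeasureTheory MeasureTheory.Measure Metric Set Filter Topology
open T5SU11Unimodular T5SU11Fibration T5SU11Cartan T5SU11OneParameter T5SU11CartanProjection T5HaarCircle
  T5BergmanCoefficient T5SU11FibrationHaar T5SU11SphericalFunction T5SU11SphericalSymmetry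
  T5SU11SphericalBounds T5SU11SphericalContinuous T5SU11JacobiIwasawa T5SU11JacobiTransform
  T5SU11JacobiWeight T5SU11KFiniteMajorantPow T5SU11PhaseLaw T5SU11PhaseLawLintegral
  T5SU11JacobiLaplacePhase T5SU11PhaseTail T5SU11PhaseTailCartan T5SU11OrbitRadiusLaw
  T5SU11JacobiPhaseTailGroup T5SU11JacobiPhaseLawAsymptotic T5SU11JacobiOrbitLawAsymptotic
  T5SU11JacobiCartanLawAsymptotic
open scoped Real

/-! ### The joint threshold -/

/-- The joint threshold `max(x/k, −½ log(1 − 2y/k), log cosh √(2z/k))`. -/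
noncomputable def jointThreshold (x y z k : ℝ) : ℝ :=
  max (x / k) (max (-(1 / 2) * Real.log (1 - 2 * y / k)) (Real.log (Real.cosh (Real.sqrt (2 * z / k)))))

/-- `(k − 2)·(x/k) → x`. -/
theorem tendsto_scaled_div_threshold (x : ℝ) :
    Tendsto (fun k : ℝ => (k - 2) * (x / k)) atTop (𝓝 x) := by
  refine (tendsto_mul_sub_two_div x).congr' (Filter.Eventually.of_forall fun k => ?_)
  ring

/-- **`(k − 2)·max(x/k, −½ log(1 − 2y/k), log cosh √(2z/k)) → max(x, y, z)`** for `y > 0`, `z ≥ 0`. -/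
theorem tendsto_scaled_joint_threshold (x : ℝ) {y z : ℝ} (hy : 0 < y) (hz : 0 ≤ z) :
    Tendsto (fun k : ℝ => (k - 2) * jointThreshold x y z k) atTop (𝓝 (max x (max y z))) := by
  have h := (tendsto_scaled_div_threshold x).max
    ((tendsto_scaled_log_threshold hy).max (tendsto_scaled_log_cosh_threshold hz))
  refine h.congr' ?_
  filter_upwards [eventually_ge_atTop (2 : ℝ)] with k hk
  simp only [jointThreshold]
  rw [mul_max_of_nonneg _ _ (by linarith), mul_max_of_nonneg _ _ (by linarith)]

/-- The joint threshold is nonnegative for `k > 0`. -/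
theorem jointThreshold_nonneg {x y z k : ℝ} (hx : 0 ≤ x) (hk : 0 < k) : 0 ≤ jointThreshold x y z k :=
  le_max_of_le_left (div_nonneg hx hk.le)

/-- **The joint event is one threshold event for the phase**: for `k > 2y`, `y > 0`, `z ≥ 0`,
`{x/k < log|a|} ∩ {2y/k < |g·0|²} ∩ {√(2z/k) < t} = {jointThreshold < log|a|}`. -/
theorem setOf_joint_gt_eq {x y z k : ℝ} (hy : 0 < y) (hk : 2 * y < k) :
    {g : SU11 | x / k < Real.log ‖mat g 0 0‖ ∧ 2 * y / k < ‖orbit g‖ ^ 2 ∧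
        Real.sqrt (2 * z / k) < cartanT g}
      = {g : SU11 | jointThreshold x y z k < Real.log ‖mat g 0 0‖} := by
  have hk0 : 0 < k := by linarith
  have hy1 : 2 * y / k < 1 := by rw [div_lt_one hk0]; linarith
  ext g
  have h1 := Set.ext_iff.mp (setOf_norm_orbit_sq_gt_eq hy1) g
  have h2 := Set.ext_iff.mp (setOf_cartanT_gt_eq (Real.sqrt_nonneg (2 * z / k))) g
  simp only [mem_setOf_eq] at h1 h2 ⊢
  rw [h1, h2, jointThreshold, max_lt_iff, max_lt_iff]

section measure

variable [MeasurableSpace Circle] [BorelSpace Circle]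

/-- **THE JOINT LIMIT LAW IS THE DIAGONAL `Exp(1)`**: for every `λ`, `x ≥ 0`, `y > 0`, `z ≥ 0`,
`P_{k,λ}(k log|a| > x, k|g·0|²/2 > y, k t²/2 > z) → e^{−max(x, y, z)}` as `k → ∞`. -/
theorem tendsto_joint_tail_prob_atTop (lam : ℝ) {x y z : ℝ} (hx : 0 ≤ x) (hy : 0 < y) (hz : 0 ≤ z) :
    Tendsto (fun k : ℝ =>
        (∫ g in {g : SU11 | x / k < Real.log ‖mat g 0 0‖ ∧ 2 * y / k < ‖orbit g‖ ^ 2 ∧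
              Real.sqrt (2 * z / k) < cartanT g},
            (1 - ‖orbit g‖ ^ 2) ^ (k / 2) * sph lam g ∂(nu haarCircle))
          / ∫ g, (1 - ‖orbit g‖ ^ 2) ^ (k / 2) * sph lam g ∂(nu haarCircle))
      atTop (𝓝 (Real.exp (-max x (max y z)))) := by
  have ht0 : ∀ᶠ k : ℝ in atTop, 0 ≤ jointThreshold x y z k := by
    filter_upwards [eventually_gt_atTop (0 : ℝ)] with k hk
    exact jointThreshold_nonneg hx hk
  have h := tendsto_phase_tail_prob_of_tendsto lam (le_max_of_le_left hx)
    (tendsto_scaled_joint_threshold x hy hz) ht0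
  refine h.congr' ?_
  filter_upwards [eventually_gt_atTop (2 * y)] with k hk
  rw [setOf_joint_gt_eq hy hk]

end measure

end Summit.Ventures.HodgeRepro2.T5SU11JacobiJointLawAsymptotic
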